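import Literature.AnabelianGeometry.SemiGraphs.PSCUnrVerticialLevelwiseProofs
import HarnessLib

/-!
# An isomorphism of quotients over `β : Π^unr_G ⥲ Π^unr_H` from a correspondence ([CombGC] Thm. 1.6 (iii), general `Σ`)

Mochizuki, *A combinatorial version of the Grothendieck conjecture*, Tohoku Math. J. **59** (2007)
[CombGC], proof of Theorem 1.6, author's manuscript p. 13 l.−8…−4: "we may assume that `Σ = {l}`" —
for assertion (iii) (`β : Π^unr_G ⥲ Π^unr_H` verticially filtration-preserving ⟹ group-theoretically
verticial) the reduction to `Σ = {l}` passes, at every `Π^unr_G`-covering `G_U` (`U ⊇ Ker(Π_G ↠ Π^unr_G)`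
open normal), to the maximal pro-`l` quotients of the unramified quotients of `Π_{G_U} = U` and of
`Π_{H_{U'}} = U'`, `U' = β(U)`.  Since `β` lives on `Π^unr_G = Π_G / Ker` and NOT on `Π_G`, the induced
isomorphism of those quotients cannot be obtained by pushing an isomorphism `U ≅ U'` forward (as for
assertions (i), (ii): abc-iut-w5-d188's `exists_over_of_ker_map_eq`); this file supplies the substitute
(row T16-L04c «(iii) general Σ» of the abc-iut cell's sub-DAG `plan/L3/SUBDAG-CombGC-Thm16.md`,
writer abc-iut-w4-d052).

* `exists_mulEquiv_of_correspondence`, `exists_continuousMulEquiv_of_correspondence` — GENERIC: a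
  subgroup `Θ ≤ A × A'` with surjective projections (a "correspondence") and surjections `φ : A ↠ R`,
  `φ' : A' ↠ R'` whose kernels correspond under `Θ` induce an isomorphism `ρ : R ≅ R'` with
  `ρ (φ x) = φ' x'` for `(x, x') ∈ Θ`; topological version (compact sources, Hausdorff targets, `Θ`
  closed): `ρ` is an isomorphism of topological groups.
* `exists_equiv_over_unrTransport` — for `β : Π^unr_G ⥲ Π^unr_H`, a level `U ⊇ Ker` with
  `β`-transport `U'`, and continuous surjections `φ : U ↠ R`, `φ' : U' ↠ R'` whose kernels correspond
  under `β` ("`φ x = 1 ↔ φ' x' = 1` whenever `β [x] = [x']`"): an isomorphism `ρ : R ≅ᵗ R'` OVER `β`.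
* `ker_iff_of_unrTransport_map_ker` — the kernel correspondence from the transport identity
  `β((ker φ)↑) = (ker φ')↑`.

Pure group theory / topology over the interface; proof-only, 0 defs; nothing here takes a side on
[IUTchIII] Cor. 3.12. [cite: MochizukiCombGC2007, Thm 1.6(iii) p.13]
-/

namespace Literature.AnabelianGeometry.SemiGraphs

open Topology

universe u

/-! ### 1. An isomorphism of quotients from a correspondence -/

section Correspondence

variable {A : Type*} [Group A] {A' : Type*} [Group A'] {R : Type*} [Group R] {R' : Type*} [Group R']

/-- **An isomorphism from a correspondence (algebraic).**  Let `Θ ≤ A × A'` be a subgroup projecting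
ONTO both factors, `φ : A ↠ R`, `φ' : A' ↠ R'` surjective homomorphisms with `φ x = 1 ↔ φ' x' = 1` for
all `(x, x') ∈ Θ`.  Then there is an isomorphism `ρ : R ≅ R'` with `ρ (φ x) = φ' x'` for all
`(x, x') ∈ Θ` (both `R`, `R'` are `Θ` modulo the common kernel of `φ ∘ pr₁`, `φ' ∘ pr₂`).
[cite: MochizukiCombGC2007, Thm 1.6(iii) p.13] -/
theorem exists_mulEquiv_of_correspondence (Θ : Subgroup (A × A')) (φ : A →* R) (φ' : A' →* R')
    (hφ : Function.Surjective φ) (hφ' : Function.Surjective φ')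
    (h₁ : ∀ x : A, ∃ x' : A', (x, x') ∈ Θ) (h₂ : ∀ x' : A', ∃ x : A, (x, x') ∈ Θ)
    (hker : ∀ p ∈ Θ, φ p.1 = 1 ↔ φ' p.2 = 1) :
    ∃ ρ : R ≃* R', ∀ (x : A) (x' : A'), (x, x') ∈ Θ → ρ (φ x) = φ' x' := by
  let ψ : Θ →* R := φ.comp ((MonoidHom.fst A A').comp Θ.subtype)
  let ψ' : Θ →* R' := φ'.comp ((MonoidHom.snd A A').comp Θ.subtype)
  have hψ : Function.Surjective ψ := by
    intro r
    obtain ⟨x, rfl⟩ := hφ r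
    obtain ⟨x', hx'⟩ := h₁ x
    exact ⟨⟨(x, x'), hx'⟩, rfl⟩
  have hψ' : Function.Surjective ψ' := by
    intro r'
    obtain ⟨x', rfl⟩ := hφ' r'
    obtain ⟨x, hx⟩ := h₂ x'
    exact ⟨⟨(x, x'), hx⟩, rfl⟩
  have hk : ψ.ker = ψ'.ker := by
    ext θ
    rw [MonoidHom.mem_ker, MonoidHom.mem_ker]
    exact hker θ.1 θ.2
  let ρ : R ≃* R' := (QuotientGroup.quotientKerEquivOfSurjective ψ hψ).symm.trans
    ((QuotientGroup.quotientMulEquivOfEq hk).trans (QuotientGroup.quotientKerEquivOfSurjective ψ' hψ'))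
  refine ⟨ρ, fun x x' hxx' => ?_⟩
  have e1 : φ x = ψ ⟨(x, x'), hxx'⟩ := rfl
  have e2 : φ' x' = ψ' ⟨(x, x'), hxx'⟩ := rfl
  have e3 : (QuotientGroup.quotientKerEquivOfSurjective ψ hψ).symm (ψ ⟨(x, x'), hxx'⟩) =
      QuotientGroup.mk ⟨(x, x'), hxx'⟩ := by
    rw [MulEquiv.symm_apply_eq]
    rfl
  rw [e1, e2]
  change QuotientGroup.quotientKerEquivOfSurjective ψ' hψ' (QuotientGroup.quotientMulEquivOfEq hk
    ((QuotientGroup.quotientKerEquivOfSurjective ψ hψ).symm (ψ ⟨(x, x'), hxx'⟩))) = _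
  rw [e3]
  rfl

variable [TopologicalSpace A] [CompactSpace A] [TopologicalSpace A'] [CompactSpace A']
variable [TopologicalSpace R] [T2Space R] [TopologicalSpace R'] [T2Space R']

/-- **An isomorphism of TOPOLOGICAL groups from a closed correspondence.**  In
`exists_mulEquiv_of_correspondence`, if `A`, `A'` are compact, `R`, `R'` Hausdorff, `φ`, `φ'` continuous
and `Θ` closed, the isomorphism `ρ` is a homeomorphism: `ρ ∘ (φ ∘ pr₁) = φ' ∘ pr₂` on the compact group
`Θ`, and `φ ∘ pr₁ : Θ ↠ R` is a quotient map. [cite: MochizukiCombGC2007, Thm 1.6(iii) p.13] -/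
theorem exists_continuousMulEquiv_of_correspondence (Θ : Subgroup (A × A'))
    (hΘ : IsClosed (Θ : Set (A × A'))) (φ : A →* R) (φ' : A' →* R')
    (hφc : Continuous φ) (hφ : Function.Surjective φ) (hφ'c : Continuous φ')
    (hφ' : Function.Surjective φ')
    (h₁ : ∀ x : A, ∃ x' : A', (x, x') ∈ Θ) (h₂ : ∀ x' : A', ∃ x : A, (x, x') ∈ Θ)
    (hker : ∀ p ∈ Θ, φ p.1 = 1 ↔ φ' p.2 = 1) :
    ∃ ρ : R ≃ₜ* R', ∀ (x : A) (x' : A'), (x, x') ∈ Θ → ρ (φ x) = φ' x' := by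
  obtain ⟨ρ, hρ⟩ := exists_mulEquiv_of_correspondence Θ φ φ' hφ hφ' h₁ h₂ hker
  haveI : CompactSpace Θ := isCompact_iff_compactSpace.mp hΘ.isCompact
  let ψ : Θ → R := fun θ => φ θ.1.1
  let ψ' : Θ → R' := fun θ => φ' θ.1.2
  have hψc : Continuous ψ := hφc.comp (continuous_fst.comp continuous_subtype_val)
  have hψ'c : Continuous ψ' := hφ'c.comp (continuous_snd.comp continuous_subtype_val)
  have hψs : Function.Surjective ψ := by
    intro r
    obtain ⟨x, rfl⟩ := hφ r
    obtain ⟨x', hx'⟩ := h₁ x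
    exact ⟨⟨(x, x'), hx'⟩, rfl⟩
  have hψ's : Function.Surjective ψ' := by
    intro r'
    obtain ⟨x', rfl⟩ := hφ' r'
    obtain ⟨x, hx⟩ := h₂ x'
    exact ⟨⟨(x, x'), hx⟩, rfl⟩
  have hq : IsQuotientMap ψ := hψc.isClosedMap.isQuotientMap hψc hψs
  have hq' : IsQuotientMap ψ' := hψ'c.isClosedMap.isQuotientMap hψ'c hψ's
  have hcomp : (ρ : R → R') ∘ ψ = ψ' := funext fun θ => hρ θ.1.1 θ.1.2 θ.2
  have hcomp' : (ρ.symm : R' → R) ∘ ψ' = ψ := funext fun θ => by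
    show ρ.symm (φ' θ.1.2) = φ θ.1.1
    rw [MulEquiv.symm_apply_eq, hρ θ.1.1 θ.1.2 θ.2]
  have hcont : Continuous ρ := by
    rw [hq.continuous_iff, hcomp]
    exact hψ'c
  have hcont' : Continuous ρ.symm := by
    rw [hq'.continuous_iff, hcomp']
    exact hψc
  exact ⟨{ ρ with continuous_toFun := hcont, continuous_invFun := hcont' }, hρ⟩

end Correspondence

/-! ### 2. Over `β : Π^unr_G ⥲ Π^unr_H` at a level `U ⊇ Ker` -/

namespace PSCDatum

variable {P : Type u} [Group P] [TopologicalSpace P] [IsTopologicalGroup P]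
variable {P' : Type u} [Group P'] [TopologicalSpace P'] [IsTopologicalGroup P']
variable (G : PSCDatum P) (H : PSCDatum P') (β : (P ⧸ G.unrKer) ≃ₜ* (P' ⧸ H.unrKer))
variable {U : Subgroup P} {U' : Subgroup P'}
variable {R : Type*} [Group R] [TopologicalSpace R] [T2Space R]
variable {R' : Type*} [Group R'] [TopologicalSpace R'] [T2Space R']

/-- Every element of a level `U` corresponds under `β` to an element of the transported level `β(U)`.
[cite: MochizukiCombGC2007, Def 1.4(iii) p.10] -/
theorem exists_mem_unrTransport_mk_eq (x : P) (hx : x ∈ U) :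
    ∃ x' ∈ G.unrTransport H β U,
      β (QuotientGroup.mk x) = (QuotientGroup.mk x' : P' ⧸ H.unrKer) := by
  obtain ⟨x', hx'⟩ := QuotientGroup.mk_surjective (β (QuotientGroup.mk x : P ⧸ G.unrKer))
  exact ⟨x', (G.mem_unrTransport_iff H β).mpr ⟨x, hx, hx'.symm⟩, hx'.symm⟩

/-- **An isomorphism over `β` at a level.**  Let `U ⊇ Ker(Π_G ↠ Π^unr_G)` be a compact level with
`β`-transport `U'`, and `φ : U ↠ R`, `φ' : U' ↠ R'` continuous surjections onto Hausdorff groups whose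
kernels correspond under `β`: `φ x = 1 ↔ φ' x' = 1` whenever `β [x] = [x']`.  Then there is an
isomorphism of topological groups `ρ : R ≅ R'` OVER `β`: `ρ (φ x) = φ' x'` whenever `β [x] = [x']`.
(The correspondence `Θ = {(x, x') ∈ U × U' | β [x] = [x']}` is a closed subgroup projecting onto both
levels.) [cite: MochizukiCombGC2007, Thm 1.6(iii) p.13] -/
theorem exists_equiv_over_unrTransport [CompactSpace U] [CompactSpace U']
    (hUU' : G.unrTransport H β U = U') (φ : U →* R) (hφc : Continuous φ)
    (hφs : Function.Surjective φ) (φ' : U' →* R') (hφ'c : Continuous φ') (hφ's : Function.Surjective φ')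
    (hker : ∀ (x : U) (x' : U'), β (QuotientGroup.mk (x : P)) = (QuotientGroup.mk (x' : P') : P' ⧸ H.unrKer) →
      (φ x = 1 ↔ φ' x' = 1)) :
    ∃ ρ : R ≃ₜ* R', ∀ (x : U) (x' : U'),
      β (QuotientGroup.mk (x : P)) = (QuotientGroup.mk (x' : P') : P' ⧸ H.unrKer) → ρ (φ x) = φ' x' := by
  haveI : IsClosed (H.unrKer : Set P') := Subgroup.isClosed_topologicalClosure _
  -- the correspondence, as the equalizer of two continuous homomorphisms `U × U' → Π^unr_H`
  let f₁ : U × U' →* P' ⧸ H.unrKer :=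
    (β.toMulEquiv.toMonoidHom.comp ((QuotientGroup.mk' G.unrKer).comp U.subtype)).comp
      (MonoidHom.fst U U')
  let f₂ : U × U' →* P' ⧸ H.unrKer :=
    ((QuotientGroup.mk' H.unrKer).comp U'.subtype).comp (MonoidHom.snd U U')
  let Θ : Subgroup (U × U') := f₁.eqLocus f₂
  have hmem : ∀ (x : U) (x' : U'), (x, x') ∈ Θ ↔
      β (QuotientGroup.mk (x : P)) = (QuotientGroup.mk (x' : P') : P' ⧸ H.unrKer) := fun x x' => Iff.rfl
  have hf₁ : Continuous f₁ :=
    (β.continuous.comp (QuotientGroup.continuous_mk.comp continuous_subtype_val)).comp continuous_fst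
  have hf₂ : Continuous f₂ :=
    (QuotientGroup.continuous_mk.comp continuous_subtype_val).comp continuous_snd
  have hΘ : IsClosed (Θ : Set (U × U')) := isClosed_eq hf₁ hf₂
  have h₁ : ∀ x : U, ∃ x' : U', (x, x') ∈ Θ := by
    intro x
    obtain ⟨x', hx'U, hx'⟩ := G.exists_mem_unrTransport_mk_eq H β (x : P) x.2
    exact ⟨⟨x', hUU' ▸ hx'U⟩, (hmem x _).mpr hx'⟩
  have h₂ : ∀ x' : U', ∃ x : U, (x, x') ∈ Θ := by
    intro x'
    have hx'U : (x' : P') ∈ G.unrTransport H β U := hUU' ▸ x'.2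
    obtain ⟨x, hxU, hx⟩ := (G.mem_unrTransport_iff H β).mp hx'U
    exact ⟨⟨x, hxU⟩, (hmem _ x').mpr hx⟩
  obtain ⟨ρ, hρ⟩ := exists_continuousMulEquiv_of_correspondence Θ hΘ φ φ' hφc hφs hφ'c hφ's h₁ h₂
    (fun p hp => hker p.1 p.2 ((hmem p.1 p.2).mp hp))
  exact ⟨ρ, fun x x' h => hρ x x' ((hmem x x').mpr h)⟩

omit [TopologicalSpace R] [T2Space R] [TopologicalSpace R'] [T2Space R'] in
/-- **The kernel correspondence from the transport identity.**  If `β` transports the kernel of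
`φ : U → R`, pushed into `Π_G` (and containing `Ker(Π_G ↠ Π^unr_G)`), onto the kernel of
`φ' : U' → R'` pushed into `Π_H`, then `φ x = 1 ↔ φ' x' = 1` whenever `β [x] = [x']`.
[cite: MochizukiCombGC2007, Def 1.4(iii) p.10] -/
theorem ker_iff_of_unrTransport_map_ker (φ : U →* R) (φ' : U' →* R')
    (hK : G.unrKer ≤ φ.ker.map U.subtype)
    (hT : G.unrTransport H β (φ.ker.map U.subtype) = φ'.ker.map U'.subtype)
    (x : U) (x' : U')
    (h : β (QuotientGroup.mk (x : P)) = (QuotientGroup.mk (x' : P') : P' ⧸ H.unrKer)) :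
    φ x = 1 ↔ φ' x' = 1 := by
  constructor
  · intro hx
    have hxL : (x : P) ∈ φ.ker.map U.subtype := ⟨x, hx, rfl⟩
    have hx'L : (x' : P') ∈ φ'.ker.map U'.subtype := by
      rw [← hT, G.mem_unrTransport_iff H β]
      exact ⟨x, hxL, h⟩
    obtain ⟨y, hy, hyx⟩ := hx'L
    rw [Subtype.ext hyx] at hy
    exact hy
  · intro hx'
    have hx'L : (x' : P') ∈ φ'.ker.map U'.subtype := ⟨x', hx', rfl⟩
    have hxL : (x : P) ∈ φ.ker.map U.subtype := by
      rw [← G.unrTransport_symm_unrTransport H β hK, H.mem_unrTransport_iff G β.symm, hT]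
      refine ⟨x', hx'L, ?_⟩
      rw [← h, ContinuousMulEquiv.symm_apply_apply]
    obtain ⟨y, hy, hyx⟩ := hxL
    rw [Subtype.ext hyx] at hy
    exact hy

end PSCDatum

end Literature.AnabelianGeometry.SemiGraphs
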